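import Mathlib
import Summits.KontsevichZagierPeriods.Zeta5Search.Families.BasicGrowth
import HarnessLib

/-!
# ζ(5) search — Families: moment asymptotics `(∫_S F^N ω)^{1/N} → sup_S F` (abstract engine)

HONEST FRAMING: systematic search; no irrationality claim unless certified.  This file contains NO statement about
zeta values; it is the measure-theoretic engine behind the growth constants of the cellular families (seat P2,
Families layer), stated abstractly so that every one-parameter family of period integrals `I(N) = ∫_S F^N ω` can use
it (basic cellular integrals: `Families/BasicGrowth.lean`; general exponent rays: `Families/RayGrowth.lean`).

Setting: a measure `μ` positive on non-empty open sets, an OPEN set `S`, a weight `ω > 0` on `S`, and a function `F`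
continuous and positive on `S`, bounded above on `S`, with `F^N ω` integrable on `S` for every `N ∈ ℕ`.  Put
`I(N) = ∫_S F^N ω dμ` and `M = sup_S F`.  PROVED:
* `moment_pos`, `moment_le_sup_pow` (`I(N) ≤ M^N I(0)`), `moment_superlevel_le` (`c^N ∫_{S∩{F>c}} ω ≤ I(N)` for
  `0 ≤ c`), `moment_superlevel_pos` (`c < M`: the superlevel set is a non-empty open set, of positive measure);
* **`tendsto_moment_root`** — `I(N)^{1/N} → M`; `tendsto_log_moment_div` — `(log I(N))/N → log M`;
* `moment_quad_nonneg`, **`moment_sq_le_mul`** (`I(N+1)² ≤ I(N) I(N+2)`, log-convexity), **`moment_ratio_mono`**,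
  **`moment_ratio_le_sup`**, **`tendsto_moment_ratio`** (`I(N+1)/I(N) ↑ M`), `sup_eq_ciSup_moment_ratio`.
Elementary (`‖F‖_{L^N(ω dμ)} → ‖F‖_{L^∞}` for a continuous function; discriminant of
`∫ F^N (F − c)² ω ≥ 0`).  Standard axioms only.
-/

noncomputable section

open MeasureTheory Set Filter Topology

namespace Summit.KontsevichZagierPeriods.Zeta5Search.Families.Moment

variable {X : Type*} [TopologicalSpace X] [MeasurableSpace X] [OpensMeasurableSpace X]
  {μ : Measure X} [μ.IsOpenPosMeasure] {S : Set X} {F ω : X → ℝ}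

open Summit.KontsevichZagierPeriods.Zeta5Search.Families.Cellular (root_pow_mul tendsto_const_mul_root)

/-! ### The moments `I(N) = ∫_S F^N ω` -/

section Moments

variable (hS : IsOpen S) (hFc : ContinuousOn F S) (hF : ∀ x ∈ S, 0 < F x) (hbdd : BddAbove (F '' S))
  (hω : ∀ x ∈ S, 0 < ω x) (hint : ∀ N : ℕ, IntegrableOn (fun x => F x ^ N * ω x) S μ)

include hS hF hω hint in
/-- The moments are positive when `S` is non-empty. -/
theorem moment_pos (hne : S.Nonempty) (N : ℕ) : 0 < ∫ x in S, F x ^ N * ω x ∂μ := by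
  have hnn : 0 ≤ᵐ[μ.restrict S] fun x => F x ^ N * ω x :=
    (ae_restrict_iff' hS.measurableSet).2 (ae_of_all _ fun x hx =>
      (mul_pos (pow_pos (hF x hx) N) (hω x hx)).le)
  rw [setIntegral_pos_iff_support_of_nonneg_ae hnn (hint N)]
  have : (Function.support fun x => F x ^ N * ω x) ∩ S = S := by
    ext x
    simp only [mem_inter_iff, Function.mem_support, and_iff_right_iff_imp]
    exact fun hx => (mul_pos (pow_pos (hF x hx) N) (hω x hx)).ne'
  rw [this]
  exact hS.measure_pos μ hne

omit [μ.IsOpenPosMeasure] in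
include hS hF hω hint in
/-- **Upper bound** `I(N) ≤ M^N · I(0)`, `M = sup_S F`. -/
theorem moment_le_sup_pow (hbdd : BddAbove (F '' S)) (N : ℕ) :
    ∫ x in S, F x ^ N * ω x ∂μ ≤ sSup (F '' S) ^ N * ∫ x in S, F x ^ 0 * ω x ∂μ := by
  rw [← integral_const_mul]
  refine setIntegral_mono_on (hint N) ((hint 0).const_mul _) hS.measurableSet fun x hx => ?_
  rw [pow_zero, one_mul]
  exact mul_le_mul_of_nonneg_right (pow_le_pow_left₀ (hF x hx).le (le_csSup hbdd ⟨x, hx, rfl⟩) N) (hω x hx).le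

omit [μ.IsOpenPosMeasure] in
include hS hFc hF hω hint in
/-- **Lower bound from a superlevel set**: `c^N · ∫_{S ∩ {F > c}} ω ≤ I(N)` for `0 ≤ c`. -/
theorem moment_superlevel_le {c : ℝ} (hc0 : 0 ≤ c) (N : ℕ) :
    c ^ N * ∫ x in S ∩ F ⁻¹' Ioi c, F x ^ 0 * ω x ∂μ ≤ ∫ x in S, F x ^ N * ω x ∂μ := by
  have hU : IsOpen (S ∩ F ⁻¹' Ioi c) := hFc.isOpen_inter_preimage hS isOpen_Ioi
  have hUS : S ∩ F ⁻¹' Ioi c ⊆ S := inter_subset_left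
  have hnn : 0 ≤ᵐ[μ.restrict S] fun x => F x ^ N * ω x :=
    (ae_restrict_iff' hS.measurableSet).2 (ae_of_all _ fun x hx =>
      (mul_pos (pow_pos (hF x hx) N) (hω x hx)).le)
  calc c ^ N * ∫ x in S ∩ F ⁻¹' Ioi c, F x ^ 0 * ω x ∂μ
      = ∫ x in S ∩ F ⁻¹' Ioi c, c ^ N * (F x ^ 0 * ω x) ∂μ := (integral_const_mul _ _).symm
    _ ≤ ∫ x in S ∩ F ⁻¹' Ioi c, F x ^ N * ω x ∂μ := by
        refine setIntegral_mono_on (((hint 0).mono_set hUS).const_mul _) ((hint N).mono_set hUS)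
          hU.measurableSet fun x hx => ?_
        rw [pow_zero, one_mul]
        exact mul_le_mul_of_nonneg_right (pow_le_pow_left₀ hc0 (le_of_lt (mem_Ioi.1 hx.2)) N) (hω x hx.1).le
    _ ≤ ∫ x in S, F x ^ N * ω x ∂μ := setIntegral_mono_set (hint N) hnn hUS.eventuallyLE

include hS hFc hF hω hint in
/-- For `c < M` the superlevel set `S ∩ {F > c}` is a non-empty open set and `0 < ∫_{S ∩ {F > c}} ω`. -/
theorem moment_superlevel_pos (hne : S.Nonempty) {c : ℝ} (hcM : c < sSup (F '' S)) :
    0 < ∫ x in S ∩ F ⁻¹' Ioi c, F x ^ 0 * ω x ∂μ := by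
  obtain ⟨_, ⟨x, hx, rfl⟩, hcx⟩ := exists_lt_of_lt_csSup (hne.image F) hcM
  have hU : IsOpen (S ∩ F ⁻¹' Ioi c) := hFc.isOpen_inter_preimage hS isOpen_Ioi
  have hnn : 0 ≤ᵐ[μ.restrict (S ∩ F ⁻¹' Ioi c)] fun y => F y ^ 0 * ω y :=
    (ae_restrict_iff' hU.measurableSet).2 (ae_of_all _ fun y hy =>
      (mul_pos (pow_pos (hF y hy.1) 0) (hω y hy.1)).le)
  rw [setIntegral_pos_iff_support_of_nonneg_ae hnn ((hint 0).mono_set inter_subset_left)]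
  have : (Function.support fun y => F y ^ 0 * ω y) ∩ (S ∩ F ⁻¹' Ioi c) = S ∩ F ⁻¹' Ioi c := by
    ext y
    simp only [mem_inter_iff, Function.mem_support, and_iff_right_iff_imp]
    exact fun hy => (mul_pos (pow_pos (hF y hy.1) 0) (hω y hy.1)).ne'
  rw [this]
  exact hU.measure_pos μ ⟨x, hx, hcx⟩

include hS hFc hF hω hint in
/-- **Moment asymptotics**: `I(N)^{1/N} → M = sup_S F` as `N → ∞` (for non-empty `S`). -/
theorem tendsto_moment_root (hne : S.Nonempty) (hbdd : BddAbove (F '' S)) :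
    Tendsto (fun N : ℕ => (∫ x in S, F x ^ N * ω x ∂μ) ^ (1 / (N : ℝ))) atTop (𝓝 (sSup (F '' S))) := by
  set I : ℕ → ℝ := fun N => ∫ x in S, F x ^ N * ω x ∂μ with hI
  have hIpos : ∀ N, 0 < I N := fun N => moment_pos hS hF hω hint hne N
  obtain ⟨x0, hx0⟩ := hne
  have hM : 0 < sSup (F '' S) := (hF x0 hx0).trans_le (le_csSup hbdd ⟨x0, hx0, rfl⟩)
  rw [tendsto_order]
  constructor
  · intro a ha
    obtain ⟨c, hac, hcM⟩ := exists_between (max_lt ha hM)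
    have hc0 : 0 ≤ c := ((le_max_right a 0).trans_lt hac).le
    have hac' : a < c := (le_max_left a 0).trans_lt hac
    set J := ∫ x in S ∩ F ⁻¹' Ioi c, F x ^ 0 * ω x ∂μ with hJ
    have hJpos : 0 < J := moment_superlevel_pos hS hFc hF hω hint ⟨x0, hx0⟩ hcM
    have hlow : ∀ N : ℕ, N ≠ 0 → c * J ^ (1 / (N : ℝ)) ≤ I N ^ (1 / (N : ℝ)) := by
      intro N hN
      rw [← root_pow_mul hc0 hJpos.le hN]
      exact Real.rpow_le_rpow (by positivity) (moment_superlevel_le hS hFc hF hω hint hc0 N) (by positivity)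
    have hev : ∀ᶠ N : ℕ in atTop, a < c * J ^ (1 / (N : ℝ)) :=
      (tendsto_order.1 (tendsto_const_mul_root c hJpos)).1 a hac'
    filter_upwards [hev, eventually_ne_atTop 0] with N h1 h2
    exact h1.trans_le (hlow N h2)
  · intro b hb
    have hup : ∀ N : ℕ, N ≠ 0 → I N ^ (1 / (N : ℝ)) ≤ sSup (F '' S) * (I 0) ^ (1 / (N : ℝ)) := by
      intro N hN
      rw [← root_pow_mul hM.le (hIpos 0).le hN]
      exact Real.rpow_le_rpow (hIpos N).le (moment_le_sup_pow hS hF hω hint hbdd N) (by positivity)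
    have hev : ∀ᶠ N : ℕ in atTop, sSup (F '' S) * (I 0) ^ (1 / (N : ℝ)) < b :=
      (tendsto_order.1 (tendsto_const_mul_root (sSup (F '' S)) (hIpos 0))).2 b hb
    filter_upwards [hev, eventually_ne_atTop 0] with N h1 h2
    exact (hup N h2).trans_lt h1

include hS hFc hF hω hint in
/-- Logarithmic form: `(log I(N))/N → log M`. -/
theorem tendsto_log_moment_div (hne : S.Nonempty) (hbdd : BddAbove (F '' S)) :
    Tendsto (fun N : ℕ => Real.log (∫ x in S, F x ^ N * ω x ∂μ) / N) atTop
      (𝓝 (Real.log (sSup (F '' S)))) := by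
  obtain ⟨x0, hx0⟩ := hne
  have hM : 0 < sSup (F '' S) := (hF x0 hx0).trans_le (le_csSup hbdd ⟨x0, hx0, rfl⟩)
  have h := ((Real.continuousAt_log hM.ne').tendsto).comp (tendsto_moment_root hS hFc hF hω hint ⟨x0, hx0⟩ hbdd)
  refine h.congr fun N => ?_
  simp only [Function.comp_apply]
  rw [Real.log_rpow (moment_pos hS hF hω hint ⟨x0, hx0⟩ N)]
  ring

/-! ### Log-convexity and the ratio limit -/

omit [μ.IsOpenPosMeasure] in
include hS hF hω hint in
/-- `c² I(N) − 2c I(N+1) + I(N+2) = ∫_S F^N (F − c)² ω ≥ 0`. -/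
theorem moment_quad_nonneg (N : ℕ) (c : ℝ) :
    0 ≤ c ^ 2 * (∫ x in S, F x ^ N * ω x ∂μ) - 2 * c * (∫ x in S, F x ^ (N + 1) * ω x ∂μ)
      + ∫ x in S, F x ^ (N + 2) * ω x ∂μ := by
  have hA : Integrable (fun x => c ^ 2 * (F x ^ N * ω x)) (μ.restrict S) := (hint N).const_mul _
  have hB : Integrable (fun x => 2 * c * (F x ^ (N + 1) * ω x)) (μ.restrict S) := (hint (N + 1)).const_mul _
  have e : ∀ x, c ^ 2 * (F x ^ N * ω x) - 2 * c * (F x ^ (N + 1) * ω x) + F x ^ (N + 2) * ω x =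
      F x ^ N * ω x * (F x - c) ^ 2 := fun x => by ring
  have hI : c ^ 2 * (∫ x in S, F x ^ N * ω x ∂μ) - 2 * c * (∫ x in S, F x ^ (N + 1) * ω x ∂μ)
      + ∫ x in S, F x ^ (N + 2) * ω x ∂μ = ∫ x in S, F x ^ N * ω x * (F x - c) ^ 2 ∂μ := by
    have s1 : ∫ x in S, (c ^ 2 * (F x ^ N * ω x) - 2 * c * (F x ^ (N + 1) * ω x) + F x ^ (N + 2) * ω x) ∂μ =
        (∫ x in S, (c ^ 2 * (F x ^ N * ω x) - 2 * c * (F x ^ (N + 1) * ω x)) ∂μ) +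
          ∫ x in S, F x ^ (N + 2) * ω x ∂μ := integral_add (hA.sub hB) (hint (N + 2))
    have s2 : ∫ x in S, (c ^ 2 * (F x ^ N * ω x) - 2 * c * (F x ^ (N + 1) * ω x)) ∂μ =
        (∫ x in S, c ^ 2 * (F x ^ N * ω x) ∂μ) - ∫ x in S, 2 * c * (F x ^ (N + 1) * ω x) ∂μ :=
      integral_sub hA hB
    rw [← integral_const_mul, ← integral_const_mul, ← s2, ← s1]
    exact integral_congr_ae (ae_of_all _ fun x => e x)
  rw [hI]
  exact setIntegral_nonneg hS.measurableSet fun x hx =>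
    mul_nonneg (mul_pos (pow_pos (hF x hx) N) (hω x hx)).le (sq_nonneg _)

include hS hF hω hint in
/-- **Log-convexity**: `I(N+1)² ≤ I(N) · I(N+2)`. -/
theorem moment_sq_le_mul (hne : S.Nonempty) (N : ℕ) :
    (∫ x in S, F x ^ (N + 1) * ω x ∂μ) ^ 2 ≤
      (∫ x in S, F x ^ N * ω x ∂μ) * ∫ x in S, F x ^ (N + 2) * ω x ∂μ := by
  set A := ∫ x in S, F x ^ N * ω x ∂μ with hA
  set B := ∫ x in S, F x ^ (N + 1) * ω x ∂μ with hB
  set C := ∫ x in S, F x ^ (N + 2) * ω x ∂μ with hC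
  have hApos : 0 < A := moment_pos hS hF hω hint hne N
  have h := moment_quad_nonneg hS hF hω hint N (B / A)
  rw [← hA, ← hB, ← hC] at h
  have h' : 0 ≤ A * ((B / A) ^ 2 * A - 2 * (B / A) * B + C) := mul_nonneg hApos.le h
  have hcalc : A * ((B / A) ^ 2 * A - 2 * (B / A) * B + C) = A * C - B ^ 2 := by
    field_simp
    ring
  linarith [hcalc ▸ h']

include hS hF hω hint in
/-- **The ratios `I(N+1)/I(N)` are non-decreasing.** -/
theorem moment_ratio_mono (hne : S.Nonempty) :
    Monotone fun N : ℕ => (∫ x in S, F x ^ (N + 1) * ω x ∂μ) / ∫ x in S, F x ^ N * ω x ∂μ := by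
  refine monotone_nat_of_le_succ fun N => ?_
  have hA := moment_pos hS hF hω hint hne N
  have hB := moment_pos hS hF hω hint hne (N + 1)
  have h := moment_sq_le_mul hS hF hω hint hne N
  rw [div_le_div_iff₀ hA hB]
  nlinarith [h]

include hS hF hω hint in
/-- **Each ratio is a lower bound for `M`**: `I(N+1)/I(N) ≤ sup_S F`. -/
theorem moment_ratio_le_sup (hne : S.Nonempty) (hbdd : BddAbove (F '' S)) (N : ℕ) :
    (∫ x in S, F x ^ (N + 1) * ω x ∂μ) / (∫ x in S, F x ^ N * ω x ∂μ) ≤ sSup (F '' S) := by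
  rw [div_le_iff₀ (moment_pos hS hF hω hint hne N), ← integral_const_mul]
  refine setIntegral_mono_on (hint (N + 1)) ((hint N).const_mul _) hS.measurableSet fun x hx => ?_
  rw [pow_succ, mul_comm (F x ^ N), mul_assoc]
  exact mul_le_mul_of_nonneg_right (le_csSup hbdd ⟨x, hx, rfl⟩)
    (mul_pos (pow_pos (hF x hx) N) (hω x hx)).le

include hS hF hω hint in
/-- `I(N) ≤ I(0) · L^N` whenever every ratio is at most `L`. -/
theorem moment_le_mul_pow_of_ratio_le (hne : S.Nonempty) {L : ℝ}
    (hL : ∀ k : ℕ, (∫ x in S, F x ^ (k + 1) * ω x ∂μ) / (∫ x in S, F x ^ k * ω x ∂μ) ≤ L) (N : ℕ) :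
    ∫ x in S, F x ^ N * ω x ∂μ ≤ (∫ x in S, F x ^ 0 * ω x ∂μ) * L ^ N := by
  induction N with
  | zero => simp
  | succ N ih =>
    have hA := moment_pos hS hF hω hint hne N
    have hL0 : 0 ≤ L :=
      (div_pos (moment_pos hS hF hω hint hne 1) (moment_pos hS hF hω hint hne 0)).le.trans (hL 0)
    have h1 : ∫ x in S, F x ^ (N + 1) * ω x ∂μ ≤ L * ∫ x in S, F x ^ N * ω x ∂μ := by
      have := hL N
      rwa [div_le_iff₀ hA] at this
    calc ∫ x in S, F x ^ (N + 1) * ω x ∂μ ≤ L * ∫ x in S, F x ^ N * ω x ∂μ := h1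
      _ ≤ L * ((∫ x in S, F x ^ 0 * ω x ∂μ) * L ^ N) := mul_le_mul_of_nonneg_left ih hL0
      _ = (∫ x in S, F x ^ 0 * ω x ∂μ) * L ^ (N + 1) := by ring

include hS hFc hF hω hint in
/-- If every ratio is at most `L` then `M ≤ L` (by the root asymptotics). -/
theorem sup_le_of_moment_ratio_le (hne : S.Nonempty) (hbdd : BddAbove (F '' S)) {L : ℝ}
    (hL : ∀ k : ℕ, (∫ x in S, F x ^ (k + 1) * ω x ∂μ) / (∫ x in S, F x ^ k * ω x ∂μ) ≤ L) :
    sSup (F '' S) ≤ L := by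
  have hL0 : 0 < L := (div_pos (moment_pos hS hF hω hint hne 1) (moment_pos hS hF hω hint hne 0)).trans_le (hL 0)
  have hI0 := moment_pos hS hF hω hint hne 0
  refine le_of_tendsto_of_tendsto (tendsto_moment_root hS hFc hF hω hint hne hbdd)
    (tendsto_const_mul_root L hI0) ?_
  filter_upwards [eventually_ne_atTop 0] with N hN
  rw [← root_pow_mul hL0.le hI0.le hN]
  refine Real.rpow_le_rpow (moment_pos hS hF hω hint hne N).le ?_ (by positivity)
  rw [mul_comm]
  exact moment_le_mul_pow_of_ratio_le hS hF hω hint hne hL N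

include hS hFc hF hω hint in
/-- **The ratio limit**: `I(N+1)/I(N) → M = sup_S F`. -/
theorem tendsto_moment_ratio (hne : S.Nonempty) (hbdd : BddAbove (F '' S)) :
    Tendsto (fun N : ℕ => (∫ x in S, F x ^ (N + 1) * ω x ∂μ) / ∫ x in S, F x ^ N * ω x ∂μ) atTop
      (𝓝 (sSup (F '' S))) := by
  set r : ℕ → ℝ := fun N => (∫ x in S, F x ^ (N + 1) * ω x ∂μ) / ∫ x in S, F x ^ N * ω x ∂μ with hr
  have hbddr : BddAbove (Set.range r) :=
    ⟨sSup (F '' S), by rintro _ ⟨N, rfl⟩; exact moment_ratio_le_sup hS hF hω hint hne hbdd N⟩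
  have hmono : Monotone r := moment_ratio_mono hS hF hω hint hne
  have hlim : Tendsto r atTop (𝓝 (⨆ N, r N)) := tendsto_atTop_ciSup hmono hbddr
  have hle : (⨆ N, r N) ≤ sSup (F '' S) := ciSup_le fun N => moment_ratio_le_sup hS hF hω hint hne hbdd N
  have hge : sSup (F '' S) ≤ ⨆ N, r N :=
    sup_le_of_moment_ratio_le hS hFc hF hω hint hne hbdd fun k => le_ciSup hbddr k
  rw [le_antisymm hle hge] at hlim
  exact hlim

include hS hFc hF hω hint in
/-- `M = sup_N I(N+1)/I(N)`. -/
theorem sup_eq_ciSup_moment_ratio (hne : S.Nonempty) (hbdd : BddAbove (F '' S)) :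
    sSup (F '' S) = ⨆ N : ℕ, (∫ x in S, F x ^ (N + 1) * ω x ∂μ) / ∫ x in S, F x ^ N * ω x ∂μ :=
  tendsto_nhds_unique (tendsto_moment_ratio hS hFc hF hω hint hne hbdd)
    (tendsto_atTop_ciSup (moment_ratio_mono hS hF hω hint hne)
      ⟨sSup (F '' S), by rintro _ ⟨N, rfl⟩; exact moment_ratio_le_sup hS hF hω hint hne hbdd N⟩)

end Moments

end Summit.KontsevichZagierPeriods.Zeta5Search.Families.Moment
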